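import Summits.BirchSwinnertonDyer.BirchSwinnertonDyer.Theorems.ByReductionTypeAtTwoRankOneAtTwoOneDoorLawSubsliceDefs
import Summits.BirchSwinnertonDyer.BirchSwinnertonDyer.Theorems.ByReductionTypeAtTwoRankOneAtTwoBigImageOddLocalOneDoorBottomOfPrintCTFree
import Summits.BirchSwinnertonDyer.BirchSwinnertonDyer.Theorems.ByReductionTypeAtTwoRankOneAtTwoBigImageOddLocalOneDoorAnalyticPrimary
import Summits.BirchSwinnertonDyer.BirchSwinnertonDyer.Theorems.ByReductionTypeAtTwoRankOneAtTwoBigImageOddLocalOneDoorGlue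
import Summits.BirchSwinnertonDyer.BirchSwinnertonDyer.Theorems.GenusKolyvaginAtTwoGenusPrimitiveSupplyAtTwoArchimedeanRowsHold
import Summits.BirchSwinnertonDyer.BirchSwinnertonDyer.Theorems.GenusKolyvaginAtTwoGenusPrimitiveSupplyAtTwoTranspositionTwistLaw
import Literature.NumberTheory.EllipticCurves.SelmerTorsionTwistRestriction
import Literature.NumberTheory.EllipticCurves.SelmerGroupCardinality
import HarnessLib

/-!
# Route ByReductionTypeAtTwo, crux `RankOneAtTwoBigImageOddLocal` (stmt-BirchSwinnertonDyer-23715), LINE v8.14 `one_door_analytic`: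
# THE DESCENT BITS OF THE PROVED SUB-SLICE — at a bottom-rung door datum `Ш(W)[2] = 0`, the EGG BIT is `1` (`Δ_W > 0`) and the
# NON-NORM BIT at the transposition prime is `1` (`Δ_W < 0`), modulo the five printed facts

Width prover seat `bsd-line-fkl-p2` g13 (2026-08-28), `--supports stmt-BirchSwinnertonDyer-23715` (helper).  THEOREMS ONLY (no definition,
no named fact, no `sorry`); every statement about a curve of the slice is CONDITIONAL on the five PRINT named facts of the line
(Gross–Zagier `gross_zagier`, Kolyvagin `kolyvagin`, modularity as a newform `exists_isNewformOf`, Hoffstein–Luo 1997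
`HoffsteinLuo1997_exists_twist_L_one_ne_zero`, Gross 1991 Prop. 3.7 (2) `GrossLMS1991.prop37_2_frobeniusCongruence`), taken as hypotheses.
BSD is not proved by any of this; nothing is asserted about the conjecture-grade residue `DoorIndexLawFullCAtTwoSomeDoorOffSubslice`.

Setting (lead g15, `Theorems/…OneDoorLawSubsliceDefs.lean`).  Skeleton v8.14 splits the crux on `HasBottomRungDoorAtTwo W` — `W` admits a
MINIMAL (`t + 2s = [Δ_W < 0]`) non-vanishing admissible door datum with ODD constant whose Heegner point is NOT `2`-divisible modulo
torsion (`m = 0`).  On that sub-slice `BSDp W 2` is a theorem modulo print and the route's rank-`0` cruxes; the complement carries the ONE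
residue.  The Defs' docstring READS the complement through the door law («`Ш(W)[2] ≠ 0`, or every minimal twin has `Ш(Wd)[2] ≠ 0` …»).
This file makes the DESCENT side of that reading a kernel theorem, with no appeal to the law:

* §1 door bookkeeping — `descAdmissible_of_doorAdmissible_of_counts_eq_zero` (`t = s = 0` ⟹ -desc's `DescAdmissible`),
  `transpAdmissible_of_doorAdmissible_of_counts` (`t = 1`, `s = 0` ⟹ -an's `TranspAdmissible` at the transposition prime);
* §2 `shaTwoTrivial_of_natCard_selmerGroup_eq_two` — `#Sel₂(W) = 2`, rank one, `E(ℚ)[2] = 0` ⟹ `Ш(W)[2] = 0` (descent count);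
* §3 AT A BOTTOM-RUNG DATUM, from print: `#Sel₂(W/ℚ) = 2` and `Sel₂(Wd/ℚ) = ⊥` (`natCard_selmerGroup_at_bottomRung_of_print`: the width
  seat g12's CT-free first-descent frame fed by the lead's leaves-from-print), hence `Ш(W)[2] = 0` (`shaTwoTrivial_at_bottomRung_of_print`)
  and `#Sel₂(W^{(d_K)}) = 1` (`twistSelmerTwoCard_eq_one_at_bottomRung_of_print`);
* §4 `Δ_W > 0`: **`meetsEgg_at_bottomRung_of_print`** — `E(ℚ)` MEETS THE EGG: a minimal door at `Δ_W > 0` is desc-admissible, and route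
  GenusKolyvaginAtTwo's THEOREM T-C `GenusKolyArch.eggTwistLawAtTwo_holds` gives `#Sel₂(W^{(d)}) = 4` at every desc-admissible `d` of a
  NON-egg curve of the locus `{Δ > 0, E(ℚ)[2] = 0, rank 1, Ш[2] = 0}` — incompatible with `#Sel₂(W^{(d_K)}) = 1`;
* §5 `Δ_W < 0`: **`meetsNonNormAt_at_bottomRung_of_print`** — `E(ℚ)` MEETS THE NON-NORM COSET at the door's transposition prime `q₀`
  (THEOREM T-q₀ `GenusKolyTransp.transpositionTwistLawAtTwo_holds`, same mechanism);
* §6 packaged forms on `HasBottomRungDoorAtTwo W` and the CONTRAPOSITIVES for the residue: modulo print, the residue's hypothesis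
  `¬ HasBottomRungDoorAtTwo W` HOLDS for every curve of the slice with `Ш(W)[2] ≠ 0` (`not_hasBottomRungDoorAtTwo_of_not_shaTwoTrivial`)
  and for every curve with `Δ_W > 0` and `E(ℚ) ⊂ E⁰(ℝ)` (`not_hasBottomRungDoorAtTwo_of_not_meetsEgg`): on these two descent-decidable
  populations EVERY minimal odd-constant non-vanishing admissible door has a `2`-DIVISIBLE Heegner point, and the residue item must
  cover them (`hasLawfulDoorAtTwo_of_offSubslice_of_not_meetsEgg`, `…_of_not_shaTwoTrivial`: the residue applies BY NAME).

So the sub-slice/residue boundary of v8.14, defined by an `∃` over Heegner data, has descent-checkable SHADOWS: egg bit (`Δ_W > 0`),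
non-norm bit at one transposition prime (`Δ_W < 0`), `Ш(W)[2]`.  (The converse shadows — egg ⟹ some minimal door has `m = 0` — are
Kolyvagin's conjecture at `2`, -an's AN-13 `HeegnerPointOnEggAtTwo`; nothing is claimed about them.)

References: [GrossLMS1991] §10; [Kolyvagin1990] Thm. A; [Kramer1981] Props. 3, 6, Thm. 1; [MazurRubin2010] Prop. 3.3, Cor. 3.4 (i);
[SilvermanAEC2009] Thm. X.4.2.
-/

set_option autoImplicit false
-- the Theorems namespace of this sub repeats the summit name by design (D-0017 nested layout)
set_option linter.dupNamespace false

noncomputable section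

open scoped Classical

namespace Summit.BirchSwinnertonDyer.BirchSwinnertonDyer.Theorems.RankOneAtTwoOneDoor

open WeierstrassCurve NumberField Literature.NumberTheory.EllipticCurves Literature.NumberTheory.EllipticCurves.ModularForms
  Summit.BirchSwinnertonDyer.Rank1Residual.F1Sign2
  Summit.BirchSwinnertonDyer.Rank1Residual.F1Sign2.TranspositionDoor
open Summit.BirchSwinnertonDyer.BirchSwinnertonDyer.Theorems.GenusKolyArch (eggTwistLawAtTwo_holds)
open Summit.BirchSwinnertonDyer.BirchSwinnertonDyer.Theorems.GenusKolyTransp (transpositionTwistLawAtTwo_holds)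

/-! ### §1 Door bookkeeping: minimal doors are desc-admissible (`Δ_W > 0`) / transposition-admissible (`Δ_W < 0`) -/

/-- At a door-admissible `d` with NO identity prime (`s(W, d) = 0`), every prime `q ∣ d` which is not a transposition prime
(`(Δ_min/q) ≠ −1`) has `a_q(W)` odd: `q` is good and odd, `q ∤ Δ_min`, so `(Δ_min/q) = +1`, and `s = 0` excludes `a_q` even.
[cite: Kramer1981, Prop. 3] -/
theorem odd_frobeniusTrace_of_identCount_eq_zero (W : WeierstrassCurve ℚ) [W.IsElliptic] [W.IsGloballyMinimal] {d : ℤ}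
    (hadm : DoorAdmissible W d) (hs : identCount W d = 0) {q : ℕ} (hq : q.Prime) (hqd : (q : ℤ) ∣ d)
    (hjq : jacobiSym W.Δ.num q ≠ -1) : Odd (W.frobeniusTrace q) := by
  obtain ⟨hdneg, -, hd8, hgoodd, -⟩ := hadm
  haveI : Fact q.Prime := ⟨hq⟩
  have hq2 : q ≠ 2 := by
    rintro rfl
    have h2d : (2 : ℤ) ∣ d := by exact_mod_cast hqd
    omega
  have hgood : W.HasGoodReductionAtPrime q := hgoodd q hq hqd ⟨hq⟩
  have hqΔmin : ¬ (q : ℤ) ∣ minimalDiscriminantInt W := not_dvd_minimalDiscriminantInt_of_hasGoodReductionAtPrime' W q hgood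
  have hnum : W.Δ.num = minimalDiscriminantInt W := by rw [← cast_minimalDiscriminantInt W, Rat.num_intCast]
  have hqΔ : ¬ (q : ℤ) ∣ W.Δ.num := by rw [hnum]; exact hqΔmin
  have hqpf : q ∈ d.natAbs.primeFactors :=
    Nat.mem_primeFactors.mpr ⟨hq, Int.ofNat_dvd_left.mp hqd, Int.natAbs_ne_zero.mpr hdneg.ne⟩
  have hgcd : Int.gcd W.Δ.num q = 1 := by
    have hcop : Nat.Coprime q W.Δ.num.natAbs :=
      (Nat.Prime.coprime_iff_not_dvd hq).mpr fun h => hqΔ (Int.ofNat_dvd_left.mpr h)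
    change W.Δ.num.natAbs.gcd (q : ℤ).natAbs = 1
    rw [Int.natAbs_natCast]
    exact hcop.symm
  have hj1 : jacobiSym W.Δ.num q = 1 := by
    rcases jacobiSym.trichotomy W.Δ.num q with h0 | h1 | hm1
    · exact absurd hgcd (jacobiSym.eq_zero_iff.mp h0).2
    · exact h1
    · exact absurd hm1 hjq
  rw [← Int.not_even_iff_odd]
  intro heven
  unfold identCount at hs
  have hmem : q ∈ d.natAbs.primeFactors.filter fun q => jacobiSym W.Δ.num q = 1 ∧ Even (W.frobeniusTrace q) :=
    Finset.mem_filter.mpr ⟨hqpf, hj1, heven⟩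
  rw [Finset.card_eq_zero] at hs
  rw [hs] at hmem
  exact Finset.notMem_empty q hmem

/-- **A `t = s = 0` door is desc-admissible**: for `d` door-admissible with no transposition and no identity prime, every `q ∣ d` is a
`3`-cycle prime (`a_q` odd), which is -desc's `DescAdmissible W d` (the parameter of T-A/T-C). [cite: Kramer1981, Prop. 3 and Prop. 6] -/
theorem descAdmissible_of_doorAdmissible_of_counts_eq_zero (W : WeierstrassCurve ℚ) [W.IsElliptic] [W.IsGloballyMinimal] {d : ℤ}
    (hadm : DoorAdmissible W d) (ht : transpCount W d = 0) (hs : identCount W d = 0) : DescAdmissible W d := by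
  have hadm' := hadm
  obtain ⟨hdneg, hsq, hd8, hgoodd, hheeg⟩ := hadm'
  refine ⟨hdneg, hsq, hd8, fun q hq hqd => ⟨hgoodd q hq hqd, ?_⟩, hheeg⟩
  refine odd_frobeniusTrace_of_identCount_eq_zero W hadm hs hq hqd ?_
  intro hj
  have hqpf : q ∈ d.natAbs.primeFactors :=
    Nat.mem_primeFactors.mpr ⟨hq, Int.ofNat_dvd_left.mp hqd, Int.natAbs_ne_zero.mpr hdneg.ne⟩
  unfold transpCount at ht
  rw [Finset.card_eq_zero] at ht
  have h1 : q ∈ d.natAbs.primeFactors.filter fun q => jacobiSym W.Δ.num q = -1 := Finset.mem_filter.mpr ⟨hqpf, hj⟩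
  rw [ht] at h1
  exact Finset.notMem_empty q h1

/-- **A `t = 1`, `s = 0` door is transposition-admissible at its transposition prime**: for `d` door-admissible with exactly one
transposition prime `q₀` and no identity prime, `(d, q₀)` is -an's `TranspAdmissible W d q₀` (the parameter of T-q₀): every other
`q ∣ d` is a `3`-cycle prime. [cite: Kramer1981, Prop. 3] [cite: MazurRubin2010, Prop. 3.3] -/
theorem transpAdmissible_of_doorAdmissible_of_counts (W : WeierstrassCurve ℚ) [W.IsElliptic] [W.IsGloballyMinimal] {d : ℤ}
    (hadm : DoorAdmissible W d) (ht : transpCount W d = 1) (hs : identCount W d = 0) {q₀ : ℕ} (hq₀ : q₀.Prime)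
    (hq₀d : (q₀ : ℤ) ∣ d) (hjac : jacobiSym W.Δ.num q₀ = -1) : TranspAdmissible W d q₀ := by
  have hadm' := hadm
  obtain ⟨hdneg, hsq, hd8, hgoodd, hheeg⟩ := hadm'
  refine ⟨hdneg, hsq, hd8, hq₀, hq₀d, hjac, fun q hq hqd => ⟨hgoodd q hq hqd, fun hne => ?_⟩, hheeg⟩
  refine odd_frobeniusTrace_of_identCount_eq_zero W hadm hs hq hqd ?_
  intro hj
  have hqpf : q ∈ d.natAbs.primeFactors :=
    Nat.mem_primeFactors.mpr ⟨hq, Int.ofNat_dvd_left.mp hqd, Int.natAbs_ne_zero.mpr hdneg.ne⟩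
  have hq₀pf : q₀ ∈ d.natAbs.primeFactors :=
    Nat.mem_primeFactors.mpr ⟨hq₀, Int.ofNat_dvd_left.mp hq₀d, Int.natAbs_ne_zero.mpr hdneg.ne⟩
  unfold transpCount at ht
  obtain ⟨a, ha⟩ := Finset.card_eq_one.mp ht
  have h1 : q ∈ d.natAbs.primeFactors.filter fun q => jacobiSym W.Δ.num q = -1 := Finset.mem_filter.mpr ⟨hqpf, hj⟩
  have h0 : q₀ ∈ d.natAbs.primeFactors.filter fun q => jacobiSym W.Δ.num q = -1 := Finset.mem_filter.mpr ⟨hq₀pf, hjac⟩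
  rw [ha, Finset.mem_singleton] at h1 h0
  exact hne (h1.trans h0.symm)

/-! ### §2 `#Sel₂(W) = 2` in rank one forces `Ш(W)[2] = 0` -/

/-- **`#Sel₂(W) = 2`, `rank E(ℚ) = 1`, `E(ℚ)[2] = 0` ⟹ `Ш(W)[2] = 0`** — the descent count `#Sel₂ = 2^{rank} · #E(ℚ)[2] · #Ш[2]`
(`card_selmerGroup_eq_pow_rank_mul`) read backwards: `2 = 2 · #E(ℚ)[2] · #Ш[2]` forces `#Ш[2] = 1`.  Converse of route GenusKolyvaginAtTwo's
`GenusKolyArch.selmerTwoCard_eq_two_of_rank_one`. [cite: SilvermanAEC2009, Thm. X.4.2] -/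
theorem shaTwoTrivial_of_natCard_selmerGroup_eq_two (W : WeierstrassCurve ℚ) [W.IsElliptic]
    (hrank : W.mordellWeilRank = 1) (h2 : Nat.card (selmerGroup W 2) = 2) : ShaTwoTrivial W := by
  have h := card_selmerGroup_eq_pow_rank_mul W 2
  rw [hrank, pow_one, Nat.cast_ofNat, h2, mul_assoc] at h
  -- `h : 2 = 2 * (#E(ℚ)[2] * #Ш[2])`
  have hab := Nat.eq_of_mul_eq_mul_left (show 0 < 2 by norm_num) (h.symm.trans (mul_one 2).symm)
  have hs := Nat.eq_one_of_mul_eq_one_left hab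
  -- `hs : #(Ш(W) ⊓ H¹(ℚ, E)[2]) = 1`
  have hbot := AddSubgroup.eq_bot_of_card_eq _ hs
  intro c hc h2c
  have hmem : c ∈ (W.sha ⊓ AddSubgroup.torsionBy W.galH1 (2 : ℤ) : AddSubgroup W.galH1) := by
    refine AddSubgroup.mem_inf.mpr ⟨hc, ?_⟩
    have h2c' : c ∈ AddSubgroup.torsionBy W.galH1 ((2 : ℕ) : ℤ) := AddSubgroup.torsionBy.nsmul_iff.mpr h2c
    rwa [Nat.cast_ofNat] at h2c'
  rw [hbot] at hmem
  exact (AddSubgroup.mem_bot).mp hmem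

/-! ### §3 At a bottom-rung datum: `#Sel₂(W/ℚ) = 2`, `Sel₂(Wd/ℚ) = ⊥`, `Ш(W)[2] = 0`, `#Sel₂(W^{(d_K)}) = 1` — modulo print -/

section AtDatum

variable
  (hGZ : ∀ (N : ℕ) [NeZero N] (W : WeierstrassCurve ℚ) (K : Type) [Field K] [NumberField K], gross_zagier N W K)
  (hKo : ∀ (N : ℕ) [NeZero N] (W : WeierstrassCurve ℚ) (K : Type) [Field K] [NumberField K], kolyvagin N W K)
  (hnf : exists_isNewformOf) (hHL : HoffsteinLuo1997_exists_twist_L_one_ne_zero)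
  (h37 : Literature.NumberTheory.EllipticCurves.GrossLMS1991.prop37_2_frobeniusCongruence)
  (W : WeierstrassCurve ℚ) [W.IsElliptic] [W.IsGloballyMinimal] [NeZero (W.conductorNorm ℤ)]
  (hCM : ¬ W.HasCM) (hsurj : ∀ n : ℕ, W.HasSurjectiveModNGaloisRep ((2 ^ n : ℕ) : ℤ)) (hT : Odd W.torsionOrder)
  (hc : Odd W.tamagawaProduct) (hr : W.analyticRank = 1)
  (K : Type) [Field K] [NumberField K] (hK : IsImaginaryQuadratic K) (hadm : DoorAdmissible W (NumberField.discr K))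
  (hLt : (W.quadraticTwist (NumberField.discr K : ℚ)).entireLFunction 1 ≠ 0)
  (Dt : ModularParametrizationData W (W.conductorNorm ℤ)) (H : HeegnerDatum (W.conductorNorm ℤ) (NumberField.discr K))
  (ι : K →+* ℂ) (P : (W.baseChange K).toAffine.Point)
  (hP : WeierstrassCurve.Affine.Point.map ι.toRatAlgHom P = heegnerPointComplex Dt H)
  (Wd : WeierstrassCurve ℚ) [Wd.IsElliptic] [Wd.IsGloballyMinimal] (Cd : WeierstrassCurve.VariableChange ℚ)
  (hWd : Cd • W.quadraticTwist (NumberField.discr K : ℚ) = Wd)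
  (hmin : transpCount W (NumberField.discr K) + 2 * identCount W (NumberField.discr K) = (if W.Δ < 0 then 1 else 0))
  (hodd : Odd Dt.c) (hm : HasTwoDivisibilityUpToTorsion W K P 0)

include hGZ hKo hnf hHL h37 hCM hsurj hT hc hr hK hadm hLt hP hWd hmin hodd hm

/-- **AT A BOTTOM-RUNG DATUM, modulo print: `#Sel₂(W/ℚ) = 2` and `Sel₂(Wd/ℚ) = ⊥`** — the conclusion of the CT-free frame
`card_selmerTwo_eq_of_input_ctFree` (width seat g12) at the first-descent input supplied by the lead's `FirstDescentLeavesAtTwoBottom` from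
Gross–Zagier, Kolyvagin, modularity, Hoffstein–Luo and Gross 3.7 (2) (`firstDescentLeavesAtTwoBottom_of_kolyvaginRelationAtTwo` ∘
`GenusExact.kolyvaginRelationAtTwo_of_frobeniusCongruence`).  Binders VERBATIM those of U₀ `DoorIndexLawUpperCAtTwoBottom`.  CONDITIONAL by design.
[cite: GrossLMS1991, §10] [cite: Kolyvagin1990, Thm. A] [cite: MazurRubin2010, Cor. 3.4 (i)] -/
theorem natCard_selmerGroup_at_bottomRung_of_print :
    Nat.card (selmerGroup W 2) = 2 ∧ selmerGroup Wd 2 = ⊥ := by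
  have hL : FirstDescentLeavesAtTwoBottom :=
    firstDescentLeavesAtTwoBottom_of_kolyvaginRelationAtTwo hGZ hKo hnf hHL
      (Summit.BirchSwinnertonDyer.BirchSwinnertonDyer.Theorems.GenusExact.kolyvaginRelationAtTwo_of_frobeniusCongruence h37)
  obtain ⟨I⟩ := hL W hCM hsurj hT hc hr K hK hadm hLt Dt H ι P hP Wd Cd hWd hmin hodd hm
  exact card_selmerTwo_eq_of_input_ctFree W hadm hmin Wd hWd I

/-- **AT A BOTTOM-RUNG DATUM, modulo print: `Ш(W)[2] = 0`** (`ShaTwoTrivial W`): `#Sel₂(W) = 2`, `rank E(ℚ) = 1` (Gross–Zagier + Kolyvagin +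
modularity + Hoffstein–Luo), `E(ℚ)[2] = 0` (odd torsion order).  CONDITIONAL by design. [cite: GrossLMS1991, §10] [cite: SilvermanAEC2009, Thm. X.4.2] -/
theorem shaTwoTrivial_at_bottomRung_of_print : ShaTwoTrivial W :=
  shaTwoTrivial_of_natCard_selmerGroup_eq_two W
    (mordellWeilRank_eq_one_of_analyticRank_eq_one_of_isGloballyMinimal hGZ hKo hnf hHL W hr).1
    (natCard_selmerGroup_at_bottomRung_of_print hGZ hKo hnf hHL h37 W hCM hsurj hT hc hr K hK hadm hLt Dt H ι P hP Wd Cd hWd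
      hmin hodd hm).1

/-- **AT A BOTTOM-RUNG DATUM, modulo print: `#Sel₂(W^{(d_K)}) = 1`** in -desc's currency `twistSelmerTwoCard` (the quadratic-twist equation and the
minimal model `Wd = Cd • W^{(d_K)}` have `2`-Selmer groups of the same order, `natCard_selmerGroup_eq_of_variableChange`).  CONDITIONAL by design.
[cite: GrossLMS1991, §10] [cite: SilvermanAEC2009, X.§4] -/
theorem twistSelmerTwoCard_eq_one_at_bottomRung_of_print : twistSelmerTwoCard W (NumberField.discr K) = 1 := by
  have hbot := (natCard_selmerGroup_at_bottomRung_of_print hGZ hKo hnf hHL h37 W hCM hsurj hT hc hr K hK hadm hLt Dt H ι P hP Wd Cd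
    hWd hmin hodd hm).2
  unfold twistSelmerTwoCard
  rw [natCard_selmerGroup_eq_of_variableChange 2 hWd, hbot, AddSubgroup.card_bot]

/-! ### §4 `Δ_W > 0`: the egg bit of a bottom-rung datum is `1` -/

/-- **AT A BOTTOM-RUNG DATUM WITH `Δ_W > 0`, modulo print: `E(ℚ)` MEETS THE EGG.**  The door is minimal (`t = s = 0`), hence desc-admissible;
on `{Δ > 0, E(ℚ)[2] = 0, rank 1, Ш[2] = 0}` (all four from §3 / print) route GenusKolyvaginAtTwo's THEOREM T-C `eggTwistLawAtTwo_holds`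
(Mazur–Rubin at the one real place; Kramer Prop. 6) says: if `E(ℚ) ⊂ E⁰(ℝ)` then `#Sel₂(W^{(d)}) = 4` at EVERY desc-admissible `d` — but the
datum's twin has `#Sel₂(W^{(d_K)}) = 1`.  Contrapositive reading: a non-egg curve of the slice has a `2`-DIVISIBLE Heegner point at every
minimal odd-constant non-vanishing admissible door.  CONDITIONAL on the five printed facts; BSD is not proved by this.
[cite: Kramer1981, Prop. 6 and Thm. 1] [cite: MazurRubin2010, Prop. 3.3] [cite: GrossLMS1991, §10] -/
theorem meetsEgg_at_bottomRung_of_print (hΔ : 0 < W.Δ) : MeetsEgg W := by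
  have hmin' := hmin
  rw [if_neg (not_lt.mpr hΔ.le)] at hmin'
  have ht : transpCount W (NumberField.discr K) = 0 := by omega
  have hs : identCount W (NumberField.discr K) = 0 := by omega
  have hdesc : DescAdmissible W (NumberField.discr K) := descAdmissible_of_doorAdmissible_of_counts_eq_zero W hadm ht hs
  have hrk : W.mordellWeilRank = 1 := (mordellWeilRank_eq_one_of_analyticRank_eq_one_of_isGloballyMinimal hGZ hKo hnf hHL W hr).1
  have hT2 : NoRationalTwoTorsion W := noRationalTwoTorsion_of_odd_torsionOrder W hT
  have hSha : ShaTwoTrivial W :=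
    shaTwoTrivial_at_bottomRung_of_print hGZ hKo hnf hHL h37 W hCM hsurj hT hc hr K hK hadm hLt Dt H ι P hP Wd Cd hWd hmin hodd hm
  have h1 : twistSelmerTwoCard W (NumberField.discr K) = 1 :=
    twistSelmerTwoCard_eq_one_at_bottomRung_of_print hGZ hKo hnf hHL h37 W hCM hsurj hT hc hr K hK hadm hLt Dt H ι P hP Wd Cd hWd
      hmin hodd hm
  by_contra hegg
  have h4 : twistSelmerTwoCard W (NumberField.discr K) = 4 := (eggTwistLawAtTwo_holds W hΔ hT2 hrk hSha _ hdesc).2 hegg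
  omega

/-! ### §5 `Δ_W < 0`: the non-norm bit at the transposition prime of a bottom-rung datum is `1` -/

/-- **AT A BOTTOM-RUNG DATUM WITH `Δ_W < 0`, modulo print: `E(ℚ)` MEETS THE NON-NORM COSET AT THE DOOR'S TRANSPOSITION PRIME** — for every
prime `q₀ ∣ d_K` with `(Δ_min/q₀) = −1` (there is exactly one: `t = 1`), some rational point reduces outside `2·Ẽ(𝔽_{q₀})`.  The door is
transposition-admissible at `q₀` (`s = 0`); on `{Δ < 0, E(ℚ)[2] = 0, rank 1, Ш[2] = 0}` route GenusKolyvaginAtTwo's THEOREM T-q₀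
`transpositionTwistLawAtTwo_holds` (Mazur–Rubin Prop. 3.3 at `T = {q₀}`; Kramer Prop. 3) says: door SHUT at `q₀` ⟹ `#Sel₂(W^{(d)}) = 4` — but the
datum's twin has `#Sel₂(W^{(d_K)}) = 1`.  Contrapositive reading: if the Legendre bit at `q₀` is `0`, every minimal odd-constant non-vanishing
door through `q₀` has a `2`-DIVISIBLE Heegner point.  CONDITIONAL on the five printed facts; BSD is not proved by this.
[cite: Kramer1981, Prop. 3] [cite: MazurRubin2010, Prop. 3.3 and Cor. 3.4 (i)] [cite: GrossLMS1991, §10] -/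
theorem meetsNonNormAt_at_bottomRung_of_print (hΔ : W.Δ < 0) (q₀ : ℕ) [hq₀ : Fact q₀.Prime]
    (hq₀d : (q₀ : ℤ) ∣ NumberField.discr K) (hjac : jacobiSym W.Δ.num q₀ = -1) : MeetsNonNormAt W q₀ := by
  obtain ⟨ht, hs⟩ := (minimal_iff_of_neg W _ hΔ).mp hmin
  have htr : TranspAdmissible W (NumberField.discr K) q₀ :=
    transpAdmissible_of_doorAdmissible_of_counts W hadm ht hs hq₀.out hq₀d hjac
  have hrk : W.mordellWeilRank = 1 := (mordellWeilRank_eq_one_of_analyticRank_eq_one_of_isGloballyMinimal hGZ hKo hnf hHL W hr).1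
  have hT2 : NoRationalTwoTorsion W := noRationalTwoTorsion_of_odd_torsionOrder W hT
  have hSha : ShaTwoTrivial W :=
    shaTwoTrivial_at_bottomRung_of_print hGZ hKo hnf hHL h37 W hCM hsurj hT hc hr K hK hadm hLt Dt H ι P hP Wd Cd hWd hmin hodd hm
  have h1 : twistSelmerTwoCard W (NumberField.discr K) = 1 :=
    twistSelmerTwoCard_eq_one_at_bottomRung_of_print hGZ hKo hnf hHL h37 W hCM hsurj hT hc hr K hK hadm hLt Dt H ι P hP Wd Cd hWd
      hmin hodd hm
  by_contra hshut
  have h4 : twistSelmerTwoCard W (NumberField.discr K) = 4 :=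
    (transpositionTwistLawAtTwo_holds W hΔ hT2 hrk hSha (NumberField.discr K) q₀ htr).2 hshut
  omega

/-- **The transposition prime of a bottom-rung datum with `Δ_W < 0` exists and carries the non-norm bit `1`** (∃-form of
`meetsNonNormAt_at_bottomRung_of_print`, the prime supplied by `exists_transpositionPrime`).  CONDITIONAL on the five printed facts.
[cite: Kramer1981, Prop. 3] [cite: MazurRubin2010, Prop. 3.3] -/
theorem exists_meetsNonNormAt_at_bottomRung_of_print (hΔ : W.Δ < 0) :
    ∃ (q₀ : ℕ) (_ : Fact q₀.Prime), (q₀ : ℤ) ∣ NumberField.discr K ∧ jacobiSym W.Δ.num q₀ = -1 ∧ MeetsNonNormAt W q₀ := by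
  obtain ⟨ht, -⟩ := (minimal_iff_of_neg W _ hΔ).mp hmin
  obtain ⟨q₀, hq₀p, hq₀d, hjac, -, -, -⟩ := exists_transpositionPrime W hadm ht
  haveI : Fact q₀.Prime := ⟨hq₀p⟩
  exact ⟨q₀, ‹Fact q₀.Prime›, hq₀d, hjac,
    meetsNonNormAt_at_bottomRung_of_print hGZ hKo hnf hHL h37 W hCM hsurj hT hc hr K hK hadm hLt Dt H ι P hP Wd Cd hWd hmin hodd hm
      hΔ q₀ hq₀d hjac⟩

end AtDatum

/-! ### §6 Packaged on `HasBottomRungDoorAtTwo W`, and the contrapositives for the v8.14 residue -/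

section Packaged

variable
  (hGZ : ∀ (N : ℕ) [NeZero N] (W : WeierstrassCurve ℚ) (K : Type) [Field K] [NumberField K], gross_zagier N W K)
  (hKo : ∀ (N : ℕ) [NeZero N] (W : WeierstrassCurve ℚ) (K : Type) [Field K] [NumberField K], kolyvagin N W K)
  (hnf : exists_isNewformOf) (hHL : HoffsteinLuo1997_exists_twist_L_one_ne_zero)
  (h37 : Literature.NumberTheory.EllipticCurves.GrossLMS1991.prop37_2_frobeniusCongruence)
  (W : WeierstrassCurve ℚ) [W.IsElliptic] [W.IsGloballyMinimal] [NeZero (W.conductorNorm ℤ)]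
  (hCM : ¬ W.HasCM) (hsurj : ∀ n : ℕ, W.HasSurjectiveModNGaloisRep ((2 ^ n : ℕ) : ℤ)) (hT : Odd W.torsionOrder)
  (hc : Odd W.tamagawaProduct) (hr : W.analyticRank = 1)

include hGZ hKo hnf hHL h37 hCM hsurj hT hc hr

/-- **THE SUB-SLICE LIES IN `{Ш(W)[2] = 0}`**, modulo print: a curve of the slice admitting a bottom-rung door datum has `Ш(W)[2] = 0`.
CONDITIONAL on the five printed facts; BSD is not proved by this. [cite: GrossLMS1991, §10] [cite: Kolyvagin1990, Thm. A] -/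
theorem shaTwoTrivial_of_hasBottomRungDoorAtTwo (hdoor : HasBottomRungDoorAtTwo W) : ShaTwoTrivial W := by
  unfold HasBottomRungDoorAtTwo at hdoor
  obtain ⟨K, iF, iN, hK, hadm, hLt, hmin, Dt, H, ι, P, Wd, iE, iM, Cd, hP, hWd, hodd, hm⟩ := hdoor
  exact shaTwoTrivial_at_bottomRung_of_print hGZ hKo hnf hHL h37 W hCM hsurj hT hc hr K hK hadm hLt Dt H ι P hP Wd Cd hWd hmin hodd hm

/-- **THE SUB-SLICE AT `Δ_W > 0` LIES IN THE EGG LOCUS**, modulo print: a curve of the slice with `Δ_W > 0` admitting a bottom-rung door datum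
has a rational point on the egg (`MeetsEgg W`).  CONDITIONAL on the five printed facts; BSD is not proved by this.
[cite: Kramer1981, Prop. 6] [cite: GrossLMS1991, §10] -/
theorem meetsEgg_of_hasBottomRungDoorAtTwo (hΔ : 0 < W.Δ) (hdoor : HasBottomRungDoorAtTwo W) : MeetsEgg W := by
  unfold HasBottomRungDoorAtTwo at hdoor
  obtain ⟨K, iF, iN, hK, hadm, hLt, hmin, Dt, H, ι, P, Wd, iE, iM, Cd, hP, hWd, hodd, hm⟩ := hdoor
  exact meetsEgg_at_bottomRung_of_print hGZ hKo hnf hHL h37 W hCM hsurj hT hc hr K hK hadm hLt Dt H ι P hP Wd Cd hWd hmin hodd hm hΔ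

/-- **ONE bottom-rung door at `Δ_W > 0` makes EVERY desc-admissible twist `Sel₂`-trivial**, modulo print: `#Sel₂(W^{(d)}) = 1` (rank `0`,
`Ш(W^{(d)})[2] = 0`) for every desc-admissible `d` — T-C's egg branch, the egg bit being `1` by `meetsEgg_of_hasBottomRungDoorAtTwo`.
CONDITIONAL on the five printed facts; BSD is not proved by this. [cite: Kramer1981, Prop. 6] [cite: GrossLMS1991, §10] -/
theorem twistSelmerTwoCard_eq_one_of_hasBottomRungDoorAtTwo_of_descAdmissible (hΔ : 0 < W.Δ) (hdoor : HasBottomRungDoorAtTwo W)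
    {d : ℤ} (hd : DescAdmissible W d) : twistSelmerTwoCard W d = 1 :=
  (eggTwistLawAtTwo_holds W hΔ (noRationalTwoTorsion_of_odd_torsionOrder W hT)
      (mordellWeilRank_eq_one_of_analyticRank_eq_one_of_isGloballyMinimal hGZ hKo hnf hHL W hr).1
      (shaTwoTrivial_of_hasBottomRungDoorAtTwo hGZ hKo hnf hHL h37 W hCM hsurj hT hc hr hdoor) d hd).1
    (meetsEgg_of_hasBottomRungDoorAtTwo hGZ hKo hnf hHL h37 W hCM hsurj hT hc hr hΔ hdoor)

/-- **`Ш(W)[2] ≠ 0` PUTS `W` OFF THE SUB-SLICE**, modulo print: the v8.14 residue's hypothesis `¬ HasBottomRungDoorAtTwo W` holds — every minimal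
odd-constant non-vanishing admissible door of such a `W` has a `2`-divisible Heegner point.  CONDITIONAL on the five printed facts.
[cite: GrossLMS1991, §10] [cite: Kolyvagin1990, Thm. A] -/
theorem not_hasBottomRungDoorAtTwo_of_not_shaTwoTrivial (hSha : ¬ ShaTwoTrivial W) : ¬ HasBottomRungDoorAtTwo W :=
  fun hdoor => hSha (shaTwoTrivial_of_hasBottomRungDoorAtTwo hGZ hKo hnf hHL h37 W hCM hsurj hT hc hr hdoor)

/-- **A NON-EGG CURVE WITH `Δ_W > 0` IS OFF THE SUB-SLICE**, modulo print: if `E(ℚ) ⊂ E⁰(ℝ)` then `¬ HasBottomRungDoorAtTwo W` — every minimal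
odd-constant non-vanishing admissible door has a `2`-divisible Heegner point.  CONDITIONAL on the five printed facts.
[cite: Kramer1981, Prop. 6] [cite: GrossLMS1991, §10] -/
theorem not_hasBottomRungDoorAtTwo_of_not_meetsEgg (hΔ : 0 < W.Δ) (hegg : ¬ MeetsEgg W) : ¬ HasBottomRungDoorAtTwo W :=
  fun hdoor => hegg (meetsEgg_of_hasBottomRungDoorAtTwo hGZ hKo hnf hHL h37 W hCM hsurj hT hc hr hΔ hdoor)

/-- **The residue COVERS the `Ш(W)[2] ≠ 0` population BY NAME**: `DoorIndexLawFullCAtTwoSomeDoorOffSubslice` (v8.14's one stub) yields a lawful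
door datum for every curve of the slice with `Ш(W)[2] ≠ 0`, its off-sub-slice hypothesis being discharged by
`not_hasBottomRungDoorAtTwo_of_not_shaTwoTrivial`.  CONDITIONAL on the residue and the five printed facts; BSD is not proved by this.
[cite: GrossLMS1991, Conj. 1.2 and §10] -/
theorem hasLawfulDoorAtTwo_of_offSubslice_of_not_shaTwoTrivial (hres : DoorIndexLawFullCAtTwoSomeDoorOffSubslice)
    (hSha : ¬ ShaTwoTrivial W) : HasLawfulDoorAtTwo W :=
  hres W hCM hsurj hT hc hr (not_hasBottomRungDoorAtTwo_of_not_shaTwoTrivial hGZ hKo hnf hHL h37 W hCM hsurj hT hc hr hSha)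

/-- **The residue COVERS the non-egg population at `Δ_W > 0` BY NAME** (off-sub-slice hypothesis discharged by
`not_hasBottomRungDoorAtTwo_of_not_meetsEgg`).  CONDITIONAL on the residue and the five printed facts; BSD is not proved by this.
[cite: GrossLMS1991, Conj. 1.2 and §10] [cite: Kramer1981, Prop. 6] -/
theorem hasLawfulDoorAtTwo_of_offSubslice_of_not_meetsEgg (hres : DoorIndexLawFullCAtTwoSomeDoorOffSubslice)
    (hΔ : 0 < W.Δ) (hegg : ¬ MeetsEgg W) : HasLawfulDoorAtTwo W :=
  hres W hCM hsurj hT hc hr (not_hasBottomRungDoorAtTwo_of_not_meetsEgg hGZ hKo hnf hHL h37 W hCM hsurj hT hc hr hΔ hegg)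

/-! ### §7 APPEND (same seat, 2026-08-28T22:0xZ) — the exponent form: on the two populations the Heegner point is `2`-DIVISIBLE -/

/-- **ON A NON-EGG CURVE WITH `Δ_W > 0`, EVERY MINIMAL ODD-CONSTANT NON-VANISHING DOOR HAS A `2`-DIVISIBLE HEEGNER POINT** (every exponent is positive),
modulo the five printed facts: the lead's `exponent_pos_of_not_hasBottomRungDoorAtTwo` at `not_hasBottomRungDoorAtTwo_of_not_meetsEgg`.  The exponent-level
reading of the companion theorem for -an's census rows (egg bit `0` ⟹ `m ≥ 1`).  CONDITIONAL by design; BSD is not proved by this.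
[cite: Kramer1981, Prop. 6] [cite: GrossLMS1991, §10] -/
theorem exponent_pos_of_not_meetsEgg (hΔ : 0 < W.Δ) (hegg : ¬ MeetsEgg W)
    (K : Type) [Field K] [NumberField K] (hK : IsImaginaryQuadratic K) (hadm : DoorAdmissible W (NumberField.discr K))
    (hLt : (W.quadraticTwist (NumberField.discr K : ℚ)).entireLFunction 1 ≠ 0)
    (hmin : transpCount W (NumberField.discr K) + 2 * identCount W (NumberField.discr K) = (if W.Δ < 0 then 1 else 0))
    (Dt : ModularParametrizationData W (W.conductorNorm ℤ)) (H : HeegnerDatum (W.conductorNorm ℤ) (NumberField.discr K))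
    (ι : K →+* ℂ) (P : (W.baseChange K).toAffine.Point)
    (hP : WeierstrassCurve.Affine.Point.map ι.toRatAlgHom P = heegnerPointComplex Dt H) (hodd : Odd Dt.c)
    (Wd : WeierstrassCurve ℚ) [Wd.IsElliptic] [Wd.IsGloballyMinimal] (Cd : WeierstrassCurve.VariableChange ℚ)
    (hWd : Cd • W.quadraticTwist (NumberField.discr K : ℚ) = Wd) (m : ℕ) (hm : HasTwoDivisibilityUpToTorsion W K P m) : 0 < m :=
  exponent_pos_of_not_hasBottomRungDoorAtTwo W (not_hasBottomRungDoorAtTwo_of_not_meetsEgg hGZ hKo hnf hHL h37 W hCM hsurj hT hc hr hΔ hegg)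
    K hK hadm hLt hmin Dt H ι P hP hodd Wd Cd hWd m hm

/-- **ON A CURVE WITH `Ш(W)[2] ≠ 0`, EVERY MINIMAL ODD-CONSTANT NON-VANISHING DOOR HAS A `2`-DIVISIBLE HEEGNER POINT** (every exponent is positive),
modulo the five printed facts (`exponent_pos_of_not_hasBottomRungDoorAtTwo` at `not_hasBottomRungDoorAtTwo_of_not_shaTwoTrivial`).  CONDITIONAL by design;
BSD is not proved by this. [cite: GrossLMS1991, §10] [cite: Kolyvagin1990, Thm. A] -/
theorem exponent_pos_of_not_shaTwoTrivial (hSha : ¬ ShaTwoTrivial W)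
    (K : Type) [Field K] [NumberField K] (hK : IsImaginaryQuadratic K) (hadm : DoorAdmissible W (NumberField.discr K))
    (hLt : (W.quadraticTwist (NumberField.discr K : ℚ)).entireLFunction 1 ≠ 0)
    (hmin : transpCount W (NumberField.discr K) + 2 * identCount W (NumberField.discr K) = (if W.Δ < 0 then 1 else 0))
    (Dt : ModularParametrizationData W (W.conductorNorm ℤ)) (H : HeegnerDatum (W.conductorNorm ℤ) (NumberField.discr K))
    (ι : K →+* ℂ) (P : (W.baseChange K).toAffine.Point)
    (hP : WeierstrassCurve.Affine.Point.map ι.toRatAlgHom P = heegnerPointComplex Dt H) (hodd : Odd Dt.c)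
    (Wd : WeierstrassCurve ℚ) [Wd.IsElliptic] [Wd.IsGloballyMinimal] (Cd : WeierstrassCurve.VariableChange ℚ)
    (hWd : Cd • W.quadraticTwist (NumberField.discr K : ℚ) = Wd) (m : ℕ) (hm : HasTwoDivisibilityUpToTorsion W K P m) : 0 < m :=
  exponent_pos_of_not_hasBottomRungDoorAtTwo W (not_hasBottomRungDoorAtTwo_of_not_shaTwoTrivial hGZ hKo hnf hHL h37 W hCM hsurj hT hc hr hSha)
    K hK hadm hLt hmin Dt H ι P hP hodd Wd Cd hWd m hm

end Packaged

end Summit.BirchSwinnertonDyer.BirchSwinnertonDyer.Theorems.RankOneAtTwoOneDoor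

end
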